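import Literature.AnabelianGeometry.SemiGraphs.SemiGraph

/-!
# Semi-graphs: pull-backs and Galois graph-coverings ([SemiAnbd] §1, p. 14)

Mochizuki, *Semi-graphs of anabelioids*, Publ. RIMS **42** (2006) 221–322, §1, author's manuscript
p. 14 [cite: MochizukiSemiAnbd2006, §1 p.14]: "just as in the case of coverings of topological
spaces, it makes sense to speak of a graph-covering as *Galois* [i.e., “arising from a normal
subgroup of the fundamental group”] and to speak of the *pull-back* of a graph-covering by an
arbitrary morphism of semi-graphs."  This file constructs the pull-back (base change)
`A ×_B B'` of any two morphisms `A → B ← B'` with its two projections (used by Theorem 1.2 (ii) and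
by §2), proves that the map a morphism induces on the branches of an edge is surjective (an
injection of 2-element sets, p. 11), and renders "Galois" combinatorially: the deck transformations
act transitively on every fibre (of vertices, of edges, of branches) of a graph-covering of
connected semi-graphs.

Deliberately NOT here: that the pull-back is a pull-back in the category of semi-graphs, and that
the base change of a (finite) graph-covering is a (finite) graph-covering (not printed as claims).
-/

namespace Literature.AnabelianGeometry.SemiGraphs

namespace SemiGraph

open CategoryTheory

universe u

/-! ### Pull-backs and Galois graph-coverings (p. 14) -/

section Pullback

variable {A B B' : SemiGraph.{u}} (φ : A ⟶ B) (π : B' ⟶ B)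

/-- Every branch of the image edge is the image of a branch: the map `e ⥲ e'` on branches is
surjective (it is an injection of 2-element sets, p. 11). [cite: MochizukiSemiAnbd2006, §1 p.11] -/
theorem Hom.exists_branchMap_eq {A B : SemiGraph.{u}} (φ : A ⟶ B) (e : A.Edge) (c : B.Branch)
    (hc : B.edgeOf c = φ.edgeMap e) : ∃ b : A.Branch, A.edgeOf b = e ∧ φ.branchMap b = c := by
  obtain ⟨b₁, b₂, hne, h₁, h₂, -⟩ := A.two_branches e
  obtain ⟨c₁, c₂, -, -, -, hall⟩ := B.two_branches (φ.edgeMap e)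
  have hφ₁ : B.edgeOf (φ.branchMap b₁) = φ.edgeMap e := by rw [φ.edgeOf_branchMap, h₁]
  have hφ₂ : B.edgeOf (φ.branchMap b₂) = φ.edgeMap e := by rw [φ.edgeOf_branchMap, h₂]
  have hne' : φ.branchMap b₁ ≠ φ.branchMap b₂ :=
    fun h => hne (φ.branchMap_injOn b₁ b₂ (h₁.trans h₂.symm) h)
  rcases hall c hc with rfl | rfl
  · rcases hall _ hφ₁ with h | h
    · exact ⟨b₁, h₁, h⟩
    · rcases hall _ hφ₂ with h' | h'
      · exact ⟨b₂, h₂, h'⟩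
      · exact absurd (h.trans h'.symm) hne'
  · rcases hall _ hφ₁ with h | h
    · rcases hall _ hφ₂ with h' | h'
      · exact absurd (h.trans h'.symm) hne'
      · exact ⟨b₂, h₂, h'⟩
    · exact ⟨b₁, h₁, h⟩

open Classical in
/-- The *pull-back* (base change) `A ×_B B'` of `π : B' → B` along `φ : A → B` (p. 14): pairs of
vertices / edges / branches with the same image; a pair of branches abuts to the pair of the
vertices its components abut to (and to no vertex otherwise).
[cite: MochizukiSemiAnbd2006, §1 p.14] -/
noncomputable def pullback : SemiGraph.{u} where
  Vertex := {p : A.Vertex × B'.Vertex // φ.vertexMap p.1 = π.vertexMap p.2}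
  Edge := {p : A.Edge × B'.Edge // φ.edgeMap p.1 = π.edgeMap p.2}
  Branch := {p : A.Branch × B'.Branch // φ.branchMap p.1 = π.branchMap p.2}
  edgeOf p := ⟨(A.edgeOf p.1.1, B'.edgeOf p.1.2), by
    rw [← φ.edgeOf_branchMap, ← π.edgeOf_branchMap, p.2]⟩
  abuts p := (A.abuts p.1.1).bind fun v => (B'.abuts p.1.2).bind fun v' =>
    if h : φ.vertexMap v = π.vertexMap v' then some ⟨(v, v'), h⟩ else none
  two_branches e := by
    obtain ⟨b₁, b₂, hne, h₁, h₂, hall⟩ := A.two_branches e.1.1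
    have hc₁ : B.edgeOf (φ.branchMap b₁) = π.edgeMap e.1.2 := by rw [φ.edgeOf_branchMap, h₁, e.2]
    have hc₂ : B.edgeOf (φ.branchMap b₂) = π.edgeMap e.1.2 := by rw [φ.edgeOf_branchMap, h₂, e.2]
    obtain ⟨b₁', h₁', e₁⟩ := Hom.exists_branchMap_eq π e.1.2 (φ.branchMap b₁) hc₁
    obtain ⟨b₂', h₂', e₂⟩ := Hom.exists_branchMap_eq π e.1.2 (φ.branchMap b₂) hc₂
    refine ⟨⟨(b₁, b₁'), e₁.symm⟩, ⟨(b₂, b₂'), e₂.symm⟩, fun h => hne (congrArg (fun p => p.1.1) h),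
      Subtype.ext (Prod.ext h₁ h₁'), Subtype.ext (Prod.ext h₂ h₂'), fun p hp => ?_⟩
    have hpA : A.edgeOf p.1.1 = e.1.1 := congrArg (fun x => x.1.1) hp
    have hpB : B'.edgeOf p.1.2 = e.1.2 := congrArg (fun x => x.1.2) hp
    rcases hall p.1.1 hpA with h | h
    · left
      have h' : p.1.2 = b₁' := π.branchMap_injOn _ _ (hpB.trans h₁'.symm) (by rw [e₁, ← h, p.2])
      exact Subtype.ext (Prod.ext h h')
    · right
      have h' : p.1.2 = b₂' := π.branchMap_injOn _ _ (hpB.trans h₂'.symm) (by rw [e₂, ← h, p.2])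
      exact Subtype.ext (Prod.ext h h')

/-- The first projection `A ×_B B' → A` of the pull-back (the base-changed morphism of `π`).
[cite: MochizukiSemiAnbd2006, §1 p.14] -/
noncomputable def pullback.fst : pullback φ π ⟶ A where
  vertexMap p := p.1.1
  edgeMap p := p.1.1
  branchMap p := p.1.1
  edgeOf_branchMap _ := rfl
  branchMap_injOn p q he h := by
    have heB : B'.edgeOf p.1.2 = B'.edgeOf q.1.2 :=
      congrArg (fun x : (pullback φ π).Edge => x.1.2) he
    have h2 : p.1.2 = q.1.2 := π.branchMap_injOn _ _ heB (by rw [← p.2, ← q.2, h])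
    exact Subtype.ext (Prod.ext h h2)
  abuts_branchMap p w hw := by
    change ((A.abuts p.1.1).bind _) = some w at hw
    cases h1 : A.abuts p.1.1 with
    | none => simp [h1] at hw
    | some v =>
      simp only [h1, Option.bind_some] at hw
      cases h2 : B'.abuts p.1.2 with
      | none => simp [h2] at hw
      | some v' =>
        simp only [h2, Option.bind_some] at hw
        split_ifs at hw with h
        cases hw
        rfl

/-- The second projection `A ×_B B' → B'` of the pull-back (the base-changed morphism `φ'` of `φ`).
[cite: MochizukiSemiAnbd2006, §1 p.14] -/
noncomputable def pullback.snd : pullback φ π ⟶ B' where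
  vertexMap p := p.1.2
  edgeMap p := p.1.2
  branchMap p := p.1.2
  edgeOf_branchMap _ := rfl
  branchMap_injOn p q he h := by
    have heA : A.edgeOf p.1.1 = A.edgeOf q.1.1 :=
      congrArg (fun x : (pullback φ π).Edge => x.1.1) he
    have h1 : p.1.1 = q.1.1 := φ.branchMap_injOn _ _ heA (by rw [p.2, q.2, h])
    exact Subtype.ext (Prod.ext h1 h)
  abuts_branchMap p w hw := by
    change ((A.abuts p.1.1).bind _) = some w at hw
    cases h1 : A.abuts p.1.1 with
    | none => simp [h1] at hw
    | some v =>
      simp only [h1, Option.bind_some] at hw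
      cases h2 : B'.abuts p.1.2 with
      | none => simp [h2] at hw
      | some v' =>
        simp only [h2, Option.bind_some] at hw
        split_ifs at hw with h
        cases hw
        rfl

/-- Pull-back along the same pair of morphisms projects compatibly: `fst ≫ φ = snd ≫ π`.
[cite: MochizukiSemiAnbd2006, §1 p.14] -/
theorem pullback.condition : pullback.fst φ π ≫ φ = pullback.snd φ π ≫ π := by
  ext p
  · exact p.2
  · exact p.2
  · exact p.2

end Pullback

/-- An automorphism of `G'` *over* `G` (a deck transformation of `π : G' → G`).
[cite: MochizukiSemiAnbd2006, §1 p.14] -/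
def IsDeckTransformation {G G' : SemiGraph.{u}} (π : G' ⟶ G) (σ : G' ≅ G') : Prop := σ.hom ≫ π = π

/-- A graph-covering `π : G' → G` of connected semi-graphs is *Galois* ("arising from a normal
subgroup of the fundamental group", p. 14), rendered combinatorially: the deck transformations act
transitively on every fibre of vertices, of edges and of branches.
[cite: MochizukiSemiAnbd2006, §1 p.14] -/
def IsGaloisGraphCovering {G G' : SemiGraph.{u}} (π : G' ⟶ G) : Prop :=
  IsGraphCovering π ∧ G.IsConnected ∧ G'.IsConnected ∧
    (∀ v₁ v₂ : G'.Vertex, π.vertexMap v₁ = π.vertexMap v₂ →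
      ∃ σ : G' ≅ G', IsDeckTransformation π σ ∧ σ.hom.vertexMap v₁ = v₂) ∧
    (∀ e₁ e₂ : G'.Edge, π.edgeMap e₁ = π.edgeMap e₂ →
      ∃ σ : G' ≅ G', IsDeckTransformation π σ ∧ σ.hom.edgeMap e₁ = e₂) ∧
    ∀ b₁ b₂ : G'.Branch, π.branchMap b₁ = π.branchMap b₂ →
      ∃ σ : G' ≅ G', IsDeckTransformation π σ ∧ σ.hom.branchMap b₁ = b₂

end SemiGraph

end Literature.AnabelianGeometry.SemiGraphs
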